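import Literature.MathematicalPhysics.KineticTheory.HardSphereEulerPrimitiveForm
import HarnessLib

/-!
# Euler in entropy variables (stub `stub_entropyVariablesProduction`, line `IdeatorTwoSketch`)

Helper file (`--supports stmt-AtomisticToContinuum-15145`) proving the registered stub R2 of the lead's skeleton for
the crux `Summit.AtomisticToContinuum.HydrodynamicLimit.Theses.TwoClocks.ClampedEntropyClock`: the POINTWISE
identity for the free-streaming rate `(∂ₜ + v·∇ₓ) g` of the one-body exponent of a local Gibbs reference
`g = log ρ + Λ(ρ) − 3/2·log(2πθ) − |v − u|²/(2θ)` along a classical hard-sphere–Euler solution with pressure law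
`p = ρθζ(ρ)` (packaged exactly as in `HardSphereEulerPrimitiveForm`: `ζ`, `Λ` smooth on an open `J` containing
the values of the density; for the route `ζ r = Z(σ³r)`, `Λ r = log Rf(σ³r)`). With `c = v − u(t,x)`:

`(∂ₜ + v·∇) g = [c⊗c − |c|²/3] : ∇u / θ + (|c|²/(2θ) − 5/2)(c·∇θ)/θ − (ζ−1)(c·∇θ)/θ + |c|² div u (1−ζ)/(3θ)`
`              + div u (ζ − 1 − ρΛ'(ρ)) + (c·∇ρ/ρ)((1−ζ) + ρΛ'(ρ) − ρζ'(ρ))`.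

Proof: the chain rule along time slices and coordinate lines (`HsEulerCalc`), the primitive equations
`IsHardSphereEulerSolution.timeDeriv_density_eq / density_mul_timeDeriv_velocity_eq / timeDeriv_temperature_eq`,
and `field_simp; ring` on the resulting jet identity (checked numerically beforehand).
-/

noncomputable section

namespace Summit.AtomisticToContinuum.HydrodynamicLimit.Theorems.QuenchedCellClock

open Set
open Literature.MathematicalPhysics.KineticTheory Literature.Analysis.FunctionSpaces
open Literature.MathematicalPhysics.KineticTheory.HsEulerCalc

/-- The squared Euclidean norm on `ℝ³` in coordinates. [folklore] -/
theorem norm_sub_sq_eq_sum (v w : V3) :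
    ‖v - w‖ ^ 2 = (v 0 - w 0) ^ 2 + (v 1 - w 1) ^ 2 + (v 2 - w 2) ^ 2 := by
  simp only [EuclideanSpace.norm_sq_eq, Fin.sum_univ_three, Real.norm_eq_abs, sq_abs, PiLp.sub_apply]

/-- **Euler in entropy variables (streaming production of the one-body exponent).** See the module docstring.
[cite: OllaVaradhanYau1993, §3] -/
theorem stub_entropyVariablesProduction {σ T : ℝ} {ρ θ : ℝ → T3 → ℝ} {u : ℝ → T3 → V3}
    {ζ Λ : ℝ → ℝ} {J : Set ℝ}
    (hE : IsHardSphereEulerSolution σ T ρ u θ) (hJ : IsOpen J)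
    (hζ : ContDiffOn ℝ (⊤ : ℕ∞) ζ J) (hΛ : ContDiffOn ℝ (⊤ : ℕ∞) Λ J)
    (hρJ : ∀ t ∈ Set.Ico 0 T, ∀ x, ρ t x ∈ J)
    (hp : ∀ t ∈ Set.Ico 0 T, ∀ x, hsPressure σ (ρ t x) (θ t x) = ρ t x * θ t x * ζ (ρ t x))
    {t : ℝ} (ht : t ∈ Set.Ico 0 T) (x : T3) (v : V3) :
    Literature.Analysis.FunctionSpaces.Torus.timeDerivWithin (Set.Ico 0 T)
        (fun s y => Real.log (ρ s y) + Λ (ρ s y) - 3 / 2 * Real.log (2 * Real.pi * θ s y) -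
          ‖v - u s y‖ ^ 2 / (2 * θ s y)) t x +
      ∑ i, v i * Literature.Analysis.FunctionSpaces.Torus.partialDeriv i
        (fun y => Real.log (ρ t y) + Λ (ρ t y) - 3 / 2 * Real.log (2 * Real.pi * θ t y) -
          ‖v - u t y‖ ^ 2 / (2 * θ t y)) x =
    (∑ i, ∑ j, ((v i - u t x i) * (v j - u t x j) - (if i = j then ‖v - u t x‖ ^ 2 / 3 else 0)) *
        Literature.Analysis.FunctionSpaces.Torus.partialDeriv i (fun y => u t y j) x) / θ t x +
      (‖v - u t x‖ ^ 2 / (2 * θ t x) - 5 / 2) *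
        (∑ i, (v i - u t x i) * Literature.Analysis.FunctionSpaces.Torus.partialDeriv i (θ t) x) / θ t x -
      (ζ (ρ t x) - 1) *
        (∑ i, (v i - u t x i) * Literature.Analysis.FunctionSpaces.Torus.partialDeriv i (θ t) x) / θ t x +
      ‖v - u t x‖ ^ 2 * (∑ i, Literature.Analysis.FunctionSpaces.Torus.partialDeriv i (fun y => u t y i) x) *
        (1 - ζ (ρ t x)) / (3 * θ t x) +
      (∑ i, Literature.Analysis.FunctionSpaces.Torus.partialDeriv i (fun y => u t y i) x) *
        (ζ (ρ t x) - 1 - ρ t x * deriv Λ (ρ t x)) +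
      (∑ i, (v i - u t x i) * Literature.Analysis.FunctionSpaces.Torus.partialDeriv i (ρ t) x) / ρ t x *
        ((1 - ζ (ρ t x)) + ρ t x * deriv Λ (ρ t x) - ρ t x * deriv ζ (ρ t x)) := by
  have hU : UniqueDiffOn ℝ (Ico (0 : ℝ) T) := uniqueDiffOn_Ico 0 T
  have hρ1 : Torus.IsContDiff 1 (ρ t) := (hE.smooth_density.isSmooth_slice ht).isContDiff (by simp)
  have hθ1 : Torus.IsContDiff 1 (θ t) :=
    (hE.smooth_temperature.isSmooth_slice ht).isContDiff (by simp)
  have hu1 : Torus.IsContDiff 1 (u t) := (hE.smooth_velocity.isSmooth_slice ht).isContDiff (by simp)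
  have huj1 : ∀ i, Torus.IsContDiff 1 (fun y => u t y i) := fun i => isContDiff_apply_coord hu1 i
  have hρ0 : 0 < ρ t x := hE.density_pos t ht x
  have hθ0 : 0 < θ t x := hE.temperature_pos t ht x
  have hρne : ρ t x ≠ 0 := hρ0.ne'
  have hθne : θ t x ≠ 0 := hθ0.ne'
  have hπθne : 2 * Real.pi * θ t x ≠ 0 := by positivity
  -- coordinate-line derivatives of the basic fields at `x`
  have cρ := fun i => hasDerivAt_coordLine hρ1 x i
  have cθ := fun i => hasDerivAt_coordLine hθ1 x i
  have cu := fun i k => hasDerivAt_coordLine (huj1 k) x i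
  have cζ := fun i => hasDerivAt_coordLine_comp hρ1 hJ hζ x (hρJ t ht x) i
  have cΛ := fun i => hasDerivAt_coordLine_comp hρ1 hJ hΛ x (hρJ t ht x) i
  -- time-slice derivatives
  have sρ := hE.smooth_density.hasDerivWithinAt_slice ht x
  have sθ := hE.smooth_temperature.hasDerivWithinAt_slice ht x
  have su := fun k => (hE.smooth_velocity.apply k).hasDerivWithinAt_slice ht x
  have hΛd : HasDerivAt Λ (deriv Λ (ρ t x)) (ρ t x) :=
    ((hΛ.differentiableOn (by simp)).differentiableAt (hJ.mem_nhds (hρJ t ht x))).hasDerivAt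
  have sΛ := hΛd.comp_hasDerivWithinAt t sρ
  -- abbreviations for the jet at `(t, x)`
  set R := ρ t x with hR
  set Θ := θ t x with hΘ
  set dρ := Torus.timeDerivWithin (Ico 0 T) ρ t x with hdρ
  set dθ := Torus.timeDerivWithin (Ico 0 T) θ t x with hdθ
  set du : Fin 3 → ℝ := fun k => Torus.timeDerivWithin (Ico 0 T) (fun s y => u s y k) t x with hdu
  set r : Fin 3 → ℝ := fun i => Torus.partialDeriv i (ρ t) x with hr
  set τ : Fin 3 → ℝ := fun i => Torus.partialDeriv i (θ t) x with hτ
  set U : Fin 3 → Fin 3 → ℝ := fun i k => Torus.partialDeriv i (fun y => u t y k) x with hUdef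
  set w : Fin 3 → ℝ := fun k => u t x k with hw
  set z := ζ (ρ t x) with hz
  set z' := deriv ζ (ρ t x) with hz'
  set l' := deriv Λ (ρ t x) with hl'
  -- (1) the time derivative of the composite
  have hT : Torus.timeDerivWithin (Ico 0 T)
      (fun s y => Real.log (ρ s y) + Λ (ρ s y) - 3 / 2 * Real.log (2 * Real.pi * θ s y) -
        ‖v - u s y‖ ^ 2 / (2 * θ s y)) t x =
      dρ / R + l' * dρ - 3 / 2 * (2 * Real.pi * dθ / (2 * Real.pi * Θ)) -
        ((∑ k, 2 * (v k - w k) * (-du k)) * (2 * Θ) - ‖v - u t x‖ ^ 2 * (2 * dθ)) / (2 * Θ) ^ 2 := by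
    refine timeDerivWithin_eq_of_hasDerivWithinAt ?_ (hU t ht)
    have hN : HasDerivWithinAt (fun s : ℝ => ‖v - u s x‖ ^ 2) (∑ k, 2 * (v k - w k) * (-du k)) (Ico 0 T) t := by
      have hfun : (fun s : ℝ => ‖v - u s x‖ ^ 2) = fun s => ∑ k, (v k - u s x k) ^ 2 := by
        funext s
        rw [norm_sub_sq_eq_sum, Fin.sum_univ_three]
      rw [hfun]
      refine HasDerivWithinAt.fun_sum fun k _ => ?_
      have h := ((su k).const_sub (v k)).pow 2
      refine h.congr_deriv ?_
      simp [hw, hdu]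
    have h := (((sρ.log hρne).add sΛ).sub (((sθ.const_mul (2 * Real.pi)).log hπθne).const_mul (3 / 2))).sub
      (hN.div (sθ.const_mul 2) (by positivity))
    refine h.congr_deriv ?_
    simp only [hR, hΘ, hdρ, hdθ, hl']
  -- (2) the coordinate-line derivatives of the composite
  have hX : ∀ i, Torus.partialDeriv i
      (fun y => Real.log (ρ t y) + Λ (ρ t y) - 3 / 2 * Real.log (2 * Real.pi * θ t y) -
        ‖v - u t y‖ ^ 2 / (2 * θ t y)) x =
      r i / R + l' * r i - 3 / 2 * (2 * Real.pi * τ i / (2 * Real.pi * Θ)) -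
        ((∑ k, 2 * (v k - w k) * (-U i k)) * (2 * Θ) - ‖v - u t x‖ ^ 2 * (2 * τ i)) / (2 * Θ) ^ 2 := by
    intro i
    refine partialDeriv_eq_of_hasDerivAt ?_
    have hN : HasDerivAt (fun s : ℝ => ‖v - u t (x + Torus.proj (s • EuclideanSpace.single i (1 : ℝ)))‖ ^ 2)
        (∑ k, 2 * (v k - w k) * (-U i k)) 0 := by
      have hfun : (fun s : ℝ => ‖v - u t (x + Torus.proj (s • EuclideanSpace.single i (1 : ℝ)))‖ ^ 2) =
          fun s => ∑ k, (v k - u t (x + Torus.proj (s • EuclideanSpace.single i (1 : ℝ))) k) ^ 2 := by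
        funext s
        rw [norm_sub_sq_eq_sum, Fin.sum_univ_three]
      rw [hfun]
      refine HasDerivAt.fun_sum fun k _ => ?_
      have h := ((cu i k).const_sub (v k)).pow 2
      refine h.congr_deriv ?_
      simp [hw, hUdef]
    have hρline : HasDerivAt (fun s : ℝ => Real.log (ρ t (x + Torus.proj (s • EuclideanSpace.single i (1 : ℝ)))))
        (r i / R) 0 := by
      have h := (cρ i).log (by simpa using hρne)
      refine h.congr_deriv ?_
      simp [hr, hR]
    have hθline : HasDerivAt
        (fun s : ℝ => Real.log (2 * Real.pi * θ t (x + Torus.proj (s • EuclideanSpace.single i (1 : ℝ)))))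
        (2 * Real.pi * τ i / (2 * Real.pi * Θ)) 0 := by
      have h := ((cθ i).const_mul (2 * Real.pi)).log (by simpa using hπθne)
      refine h.congr_deriv ?_
      simp [hτ, hΘ]
    have hΛline : HasDerivAt (fun s : ℝ => Λ (ρ t (x + Torus.proj (s • EuclideanSpace.single i (1 : ℝ)))))
        (l' * r i) 0 := by
      refine (cΛ i).congr_deriv ?_
      simp [hl', hr]
    have hθline' : HasDerivAt (fun s : ℝ => 2 * θ t (x + Torus.proj (s • EuclideanSpace.single i (1 : ℝ))))
        (2 * τ i) 0 := by
      refine ((cθ i).const_mul 2).congr_deriv ?_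
      simp [hτ]
    have h := ((hρline.add hΛline).sub (hθline.const_mul (3 / 2))).sub
      (hN.div hθline' (by simpa using (show (2 : ℝ) * θ t x ≠ 0 by positivity)))
    refine h.congr_deriv ?_
    simp only [zero_smul, Torus.proj_zero, add_zero, hΘ]
  -- (3) the primitive equations at `(t, x)`
  have hP1 : dρ = -∑ i, (R * U i i + r i * w i) := by
    simpa [hdρ, hR, hUdef, hr, hw] using hE.timeDeriv_density_eq ht x
  have hP2 : ∀ j, R * du j = -(R * ∑ i, w i * U i j) - (Θ * (z + R * z') * r j + R * z * τ j) := by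
    intro j
    simpa [hR, hdu, hw, hUdef, hΘ, hz, hz', hr, hτ] using
      hE.density_mul_timeDeriv_velocity_eq hJ hζ hρJ hp ht x j
  have hP3 : dθ = -(∑ i, w i * τ i) - 2 / 3 * (Θ * z) * ∑ i, U i i := by
    simpa [hdθ, hw, hτ, hΘ, hz, hUdef] using hE.timeDeriv_temperature_eq hJ hζ hρJ hp ht x
  have hdu : ∀ j, du j = (-(R * ∑ i, w i * U i j) - (Θ * (z + R * z') * r j + R * z * τ j)) / R := by
    intro j
    rw [eq_div_iff hρne, mul_comm]
    exact hP2 j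
  -- (4) assemble: everything is now an explicit rational expression in the jet
  have hn : ‖v - u t x‖ ^ 2 = (v 0 - w 0) ^ 2 + (v 1 - w 1) ^ 2 + (v 2 - w 2) ^ 2 := by
    rw [norm_sub_sq_eq_sum]
  rw [hT]
  simp only [hX]
  simp only [Fin.sum_univ_three, Fin.isValue, hn] at hP1 hP3 hdu ⊢
  simp only [show ((0 : Fin 3) = 1) = False from by simp,
    show ((0 : Fin 3) = 2) = False from by simp, show ((1 : Fin 3) = 0) = False from by simp,
    show ((1 : Fin 3) = 2) = False from by simp, show ((2 : Fin 3) = 0) = False from by simp,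
    show ((2 : Fin 3) = 1) = False from by simp, if_true, if_false]
  rw [hP1, hP3, hdu 0, hdu 1, hdu 2]
  have hπ : Real.pi ≠ 0 := Real.pi_ne_zero
  field_simp
  ring

end Summit.AtomisticToContinuum.HydrodynamicLimit.Theorems.QuenchedCellClock

end
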